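/-
LINE «theta-uniform» for crux item stmt-RiemannHypothesis-25784 (`IntegerScrew.TwoPrimeFoldRigidity`), registered by
cdisprove-25784 g0 on director-rh (CA76)(2): this is rh-idea-w9 g0's typed anchor `TwoLatticeSketch.lean`
(be6b9df9a8b95cd6, W-05 gen-2 cell C1, critic PASS ×2 on the obstruction side) VERBATIM (§1–§4), plus §5: the owed
stubs of theorem-candidate T2 «θ-UNIFORM MULTI-LATTICE TOWER» (U1 dust-inclusive coupled majorant, U2 height law,
U3 assembly — MAP-W05-gen2-w9-C1-twolattice.md §3) recorded as ONE sorried stub `stub_T2`, and the dictionary stub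
`stub_K1_of_T2` (T2 at (log 2, log 3, σ* = 1/2) ⇒ ¬K1: needs the `modelPsi` ↔ fold-sum dictionary and an `ι ⊕ ι`
re-indexing), composed kernel-side into `TwoPrimeFoldRigidity_false_of_T2`.  Nothing here bears on the truth of RH.

ORIGINAL HEADER (w9):
rh-idea-w9 g0 (WIDTH COPY «width 9» of rh-idea-1), W-05 gen-2 cell C1 «TWO-LATTICE REDUCTION» (director-rh (CA72)).
Scratch / typed anchor only — NOT filed, no registry verbs.  ζ-free except through the tree's `zetaScrew` and
Mathlib's `RiemannHypothesis`.  Nothing here bears on the truth of RH.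

CONTENTS
§1  `LatPos h`            — B-half of survivor X-8 (`ScrewLatticeFoz.foz_and_latticePos_iff_rh`).
    `TwoLatticeReduction` — the reduction C1 hopes for, typed: `LatPos h → LatPos h' → RiemannHypothesis`.
    `twoLatticeReduction_iff` — it is equivalent to `(LatPos h ∧ LatPos h') ↔ RH` (RH ⇒ LatPos is in the tree).
§2  `TwoLatticeBlind h₁ h₂ σs` — the two-lattice blind configuration (B16/B26 class clauses VERBATIM, the two
    lattice clauses — uniform floor/ceiling and `LPSD` — demanded on BOTH lattices `h₁ℕ`, `h₂ℕ`).
    `twoLatticeBlind_of_commensurable` — PROVED: if `h₁ = p·h`, `h₂ = q·h` (`p, q ≥ 1`), the tree's one-lattice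
    model at the common refinement `h` is blind to both (so commensurable pairs carry one lattice's information).
§3  `MultiLatticeTowerBarrier` — THEOREM-CANDIDATE T2 (not proved here): `TwoLatticeBlind h₁ h₂ σs` for ALL
    `h₁, h₂, σs > 0`; mechanism = alias-engineered interleaved residual towers (memo MAP-W05-gen2-w9-C1-twolattice.md §3).
§4  `TwoLatticeImpersonation` / `MultiLatticeImpersonationBarrier` — Q-W10's sharpened C1 target typed (T2′, candidate).
-/
import Summits.RiemannHypothesis.RiemannHypothesis.Theses.IntegerScrew
import Summits.RiemannHypothesis.RiemannHypothesis.Theorems.Splittings.ScrewLatticeFozC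
import Summits.RiemannHypothesis.RiemannHypothesis.Theorems.Splittings.ScrewLatticeWolffModel
import HarnessLib

set_option linter.dupNamespace false

noncomputable section

open Complex Set

namespace Summit.RiemannHypothesis.RiemannHypothesis.Cells.RhIdeaW9

open Literature.NumberTheory.LFunctions
open Summit.RiemannHypothesis.RiemannHypothesis.Theorems.Splittings
open Summit.RiemannHypothesis.RiemannHypothesis.Theorems.Splittings.ScrewLatticeWolff
open Summit.RiemannHypothesis.RiemannHypothesis.Theorems.Splittings.ScrewLatticeWolffModel

/-! ## §1 The object and the hoped-for reduction -/

/-- `LAT(h)`: lattice positivity of Suzuki's screw function, the B-half of survivor X-8. -/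
def LatPos (h : ℝ) : Prop := ∀ k : ℕ, 0 ≤ zetaScrew (k * h)

/-- C1's question, typed: do two lattices decide RH? -/
def TwoLatticeReduction (h h' : ℝ) : Prop := LatPos h → LatPos h' → _root_.RiemannHypothesis

/-- `RH ⇒ LAT(h)` for every `h` is in the tree, so the reduction is the same as the biconditional. -/
theorem twoLatticeReduction_iff (h h' : ℝ) :
    TwoLatticeReduction h h' ↔ ((LatPos h ∧ LatPos h') ↔ _root_.RiemannHypothesis) := by
  constructor
  · intro H
    exact ⟨fun hp ↦ H hp.1 hp.2,
      fun hRH ↦ ⟨ScrewLatticeFoz.latticePos_of_rh hRH h, ScrewLatticeFoz.latticePos_of_rh hRH h'⟩⟩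
  · intro H h1 h2
    exact H.1 ⟨h1, h2⟩

/-- TEST 0 anchor: with `CofiniteCriticalLine` EITHER lattice already decides RH (X-8, by name). -/
theorem foz_and_latPos_iff_rh {h : ℝ} (hh : 0 < h) :
    (Theses.RuelleBand.CofiniteCriticalLine ∧ LatPos h) ↔ _root_.RiemannHypothesis :=
  ScrewLatticeFoz.foz_and_latticePos_iff_rh hh

/-! ## §2 The two-lattice blind configuration -/

/-- **Two-lattice blind configuration** (class clauses of `ScrewLatticeWolffModel.exists_blind_model`
verbatim; the lattice clauses on BOTH `h₁ℕ` and `h₂ℕ`).  An obstruction statement about zero-side lattice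
criteria; RH-free. -/
def TwoLatticeBlind (h₁ h₂ σs : ℝ) : Prop :=
    ∃ (ι : Type) (m₁ m₂ : ι → ℝ) (κ₁ κ₂ : ι → ℂ),
      Nonempty ι ∧
      (∀ i, 0 < m₁ i ∧ 0 < m₂ i) ∧
      (∀ i, 0 < (κ₁ i).re ∧ (κ₁ i).re < σs ∧ (κ₂ i).re = (κ₁ i).re) ∧
      (∀ i, 14 < (κ₁ i).im ∧ 14 < (κ₂ i).im) ∧
      (∀ T : ℝ, {i | (κ₁ i).im ≤ T}.Finite ∧ {i | (κ₂ i).im ≤ T}.Finite) ∧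
      Summable (fun i ↦ m₁ i / (κ₁ i).im ^ 2 + m₂ i / (κ₂ i).im ^ 2) ∧
      (∀ i, ∃ j, (κ₁ i).re < (κ₁ j).re) ∧
      (∃ A : ℝ, 0 < A ∧ ∀ k : ℕ, 1 ≤ k →
          2 * A ≤ modelPsi m₁ m₂ κ₁ κ₂ (k * h₁) ∧ modelPsi m₁ m₂ κ₁ κ₂ (k * h₁) ≤ 6 * A) ∧
      (∀ (N : ℕ) (t x : Fin N → ℝ), (∀ a, t a ∈ Set.range fun k : ℕ ↦ (k : ℝ) * h₁) →
          0 ≤ ∑ a, ∑ b, (modelPsi m₁ m₂ κ₁ κ₂ (t a) + modelPsi m₁ m₂ κ₁ κ₂ (t b)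
            - modelPsi m₁ m₂ κ₁ κ₂ (t a - t b)) * (x a * x b)) ∧
      (∃ A : ℝ, 0 < A ∧ ∀ k : ℕ, 1 ≤ k →
          2 * A ≤ modelPsi m₁ m₂ κ₁ κ₂ (k * h₂) ∧ modelPsi m₁ m₂ κ₁ κ₂ (k * h₂) ≤ 6 * A) ∧
      (∀ (N : ℕ) (t x : Fin N → ℝ), (∀ a, t a ∈ Set.range fun k : ℕ ↦ (k : ℝ) * h₂) →
          0 ≤ ∑ a, ∑ b, (modelPsi m₁ m₂ κ₁ κ₂ (t a) + modelPsi m₁ m₂ κ₁ κ₂ (t b)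
            - modelPsi m₁ m₂ κ₁ κ₂ (t a - t b)) * (x a * x b))

/-- **Commensurable pairs carry one lattice.**  If `h₁ = p h` and `h₂ = q h` with `p, q ≥ 1`, the tree's
one-lattice blind model at the common refinement `h` (`exists_blind_model`) is blind to both lattices:
`h₁ℕ ∪ h₂ℕ ⊆ hℕ`.  RH-free; an immediate corollary. -/
theorem twoLatticeBlind_of_commensurable {h σs : ℝ} (hh : 0 < h) (hσs : 0 < σs) {p q : ℕ}
    (hp : 1 ≤ p) (hq : 1 ≤ q) : TwoLatticeBlind (p * h) (q * h) σs := by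
  obtain ⟨ι, m₁, m₂, κ₁, κ₂, hne, hm, hre, him, hfin, hsum, hsup, ⟨A, hA, hfl⟩, hpsd⟩ :=
    exists_blind_model hh hσs
  have sub : ∀ (r : ℕ), ∀ x ∈ Set.range (fun k : ℕ ↦ (k : ℝ) * (r * h)),
      x ∈ Set.range (fun k : ℕ ↦ (k : ℝ) * h) := by
    rintro r x ⟨k, rfl⟩
    exact ⟨k * r, by push_cast; ring⟩
  have fl : ∀ (r : ℕ), 1 ≤ r → ∀ k : ℕ, 1 ≤ k →
      2 * A ≤ modelPsi m₁ m₂ κ₁ κ₂ (k * (r * h)) ∧ modelPsi m₁ m₂ κ₁ κ₂ (k * (r * h)) ≤ 6 * A := by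
    intro r hr k hk
    have e : (k : ℝ) * (r * h) = ((k * r : ℕ) : ℝ) * h := by push_cast; ring
    rw [e]
    exact hfl (k * r) (Nat.one_le_iff_ne_zero.mpr (Nat.mul_ne_zero (by omega) (by omega)))
  refine ⟨ι, m₁, m₂, κ₁, κ₂, hne, hm, hre, him, hfin, hsum, hsup, ⟨A, hA, fl p hp⟩, ?_, ⟨A, hA, fl q hq⟩, ?_⟩
  · intro N t x ht
    exact hpsd N t x (fun a ↦ sub p (t a) (ht a))
  · intro N t x ht
    exact hpsd N t x (fun a ↦ sub q (t a) (ht a))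

/-! ## §3 The theorem-candidate (NOT proved here) -/

/-- **T2 «MULTI-LATTICE TOWER» (theorem-candidate, B26-ter).**  For EVERY pair of steps and every `σ* > 0`
a two-lattice blind configuration exists — incommensurability does not kill the aliasing obstruction.
Mechanism (memo §3): interleaved residual towers, one per lattice, each block an exact regular polygon for its
own lattice and ALIAS-ENGINEERED (Kronecker density of `N·h₂/h₁ mod 1` + a positive solution of a finite
linear system near the uniform one) to be exactly invisible to the other lattice below its order and an
approximate regular `dL`-gon (`L ≥ 2h₁/h₂`) above it.  Stated, not proved. -/
def MultiLatticeTowerBarrier : Prop :=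
  ∀ h₁ h₂ σs : ℝ, 0 < h₁ → 0 < h₂ → 0 < σs → TwoLatticeBlind h₁ h₂ σs

/-- The commensurable instances of T2 hold now. -/
theorem multiLatticeTowerBarrier_commensurable {h σs : ℝ} (hh : 0 < h) (hσs : 0 < σs) {p q : ℕ}
    (hp : 1 ≤ p) (hq : 1 ≤ q) : TwoLatticeBlind (p * h) (q * h) σs :=
  twoLatticeBlind_of_commensurable hh hσs hp hq

/-! ## §4 Two-lattice impersonation (Q-W10's sharpened C1 target, typed; NOT proved here) -/

/-- **Two-lattice impersonation of one critical zero** (Q-W10 ↦ C1, typed).  A class configuration (clauses of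
`TwoLatticeBlind` minus the floor/ceiling/LPSD lines) whose model screw function on BOTH lattices `h₁ℕ`, `h₂ℕ`
equals, up to a geometrically small error, the lattice signature `C (1 − cos (k φᵢ))` of ONE critical zero of
weight `C` at CONSISTENT phases `φ₂ = φ₁ h₂ / h₁` (i.e. ordinate `γ = φ₁ / h₁`).  The constant `C = −4 Σ m Re κ⁻²`
of a class configuration is lattice-independent, which is what makes consistent weights automatic.  RH-free. -/
def TwoLatticeImpersonation (h₁ h₂ σs φ₁ : ℝ) : Prop :=
    ∃ (ι : Type) (m₁ m₂ : ι → ℝ) (κ₁ κ₂ : ι → ℂ),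
      Nonempty ι ∧
      (∀ i, 0 < m₁ i ∧ 0 < m₂ i) ∧
      (∀ i, 0 < (κ₁ i).re ∧ (κ₁ i).re < σs ∧ (κ₂ i).re = (κ₁ i).re) ∧
      (∀ i, 14 < (κ₁ i).im ∧ 14 < (κ₂ i).im) ∧
      (∀ T : ℝ, {i | (κ₁ i).im ≤ T}.Finite ∧ {i | (κ₂ i).im ≤ T}.Finite) ∧
      Summable (fun i ↦ m₁ i / (κ₁ i).im ^ 2 + m₂ i / (κ₂ i).im ^ 2) ∧
      (∀ i, ∃ j, (κ₁ i).re < (κ₁ j).re) ∧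
      (∃ C δ : ℝ, 0 < C ∧ 0 < δ ∧
        (∀ k : ℕ, 1 ≤ k →
          |modelPsi m₁ m₂ κ₁ κ₂ (k * h₁) - C * (1 - Real.cos (k * φ₁))| ≤ C * Real.exp (-(δ * k))) ∧
        (∀ k : ℕ, 1 ≤ k →
          |modelPsi m₁ m₂ κ₁ κ₂ (k * h₂) - C * (1 - Real.cos (k * (φ₁ * h₂ / h₁)))| ≤ C * Real.exp (-(δ * k))))

/-- **T2′ (theorem-candidate).**  Two-lattice impersonation exists for every pair of steps, every `σ* > 0` and every
phase: the SAME interleaved alias-engineered towers as T2, run with the normalised targets `C e^{ikφᵢ} e^{-σ* k hᵢ}`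
in place of `0` (the residual recursion is linear; the targets are a summable forcing).  Stated, not proved. -/
def MultiLatticeImpersonationBarrier : Prop :=
  ∀ h₁ h₂ σs φ₁ : ℝ, 0 < h₁ → 0 < h₂ → 0 < σs → TwoLatticeImpersonation h₁ h₂ σs φ₁

/-! ## §5 (cdisprove-25784 g0) Stubs owed by T2 and the composition T2 ⇒ ¬K1

* `stub_T2` — T2 itself (`MultiLatticeTowerBarrier`).  Its informal sub-stubs (MAP-W05 §3): **U1** a dust-inclusive
  coupled majorant for the two interleaved residual towers (each block's spill onto the OTHER lattice, summed over the
  Kronecker-steered alias defects, is dominated by a summable profile); **U2** the height law (base heights can be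
  chosen level by level so that local finiteness and `Σ m/γ² < ∞` survive the steering); **U3** assembly (floors,
  LPSD and the `∀ i ∃ j, Re κ i < Re κ j` clause from U1+U2).  Which of U1–U3 fails, if any, is the census asked for
  by (CA76)(2).
* `stub_K1_of_T2` — dictionary: a `TwoLatticeBlind (log 2) (log 3) (1/2)` configuration, re-indexed over `ι ⊕ ι`
  (pairs `(m₁, κ₁)`, `(m₂, κ₂)` flattened), satisfies every hypothesis of `TwoPrimeFoldRigidity` (the fold sum
  `Σ 4m Re[(cosh κt − 1)/κ²]` is `modelPsi` up to the tree's normalisation, bounded by the ceiling `6A`), whence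
  `IsEmpty (ι ⊕ ι)`, contradicting `Nonempty ι`.
-/

/-- [stub T2] the θ-uniform multi-lattice tower (U1 + U2 + U3). -/
theorem stub_T2 : MultiLatticeTowerBarrier := by
  sorry

/-- [stub D] dictionary `TwoLatticeBlind (log 2) (log 3) (1/2)` ⇒ `¬ TwoPrimeFoldRigidity`. -/
theorem stub_K1_of_T2 : TwoLatticeBlind (Real.log 2) (Real.log 3) (1 / 2) →
    ¬ Summit.RiemannHypothesis.RiemannHypothesis.Theses.IntegerScrew.TwoPrimeFoldRigidity := by
  sorry

/-- Kernel-checked composition (no sorry in this declaration): T2 ⇒ K1 is false as typed. -/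
theorem TwoPrimeFoldRigidity_false_of_T2 :
    ¬ Summit.RiemannHypothesis.RiemannHypothesis.Theses.IntegerScrew.TwoPrimeFoldRigidity :=
  stub_K1_of_T2 (stub_T2 _ _ _ (Real.log_pos (by norm_num)) (Real.log_pos (by norm_num)) (by norm_num))

end Summit.RiemannHypothesis.RiemannHypothesis.Cells.RhIdeaW9
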